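import Literature.NumberTheory.LFunctions.VolchkovCriterionProofs
import Literature.NumberTheory.LFunctions.ZetaArgVariation
import Mathlib.Analysis.SpecialFunctions.ImproperIntegrals
import Mathlib.MeasureTheory.Integral.Prod
import HarnessLib

/-!
# RH-EQUIVALENT (PROVED AS AN EQUIVALENCE) · Volchkov's criterion in its `arg ζ` form `∫₀^∞ 2t·S(t)/(1/4+t²)² dt = γ − 3 ⟺ RH` — discharge of `Volchkov1995_criterion_argForm`; nothing here bears on the truth of RH

Literature-typing tranche `rh-lit-broughan-2` (Broughan, *Equivalents of the Riemann Hypothesis*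
Vol. 2, Ch. 8; the volume is not held). This file DISCHARGES the named fact
`Literature.NumberTheory.LFunctions.Volchkov1995_criterion_argForm` of
`VolchkovTypeIntegralCriteria.lean` (V. V. Volchkov, Ukr. Mat. Zh. 47 (1995) 422–423; as printed in
Sekatskii–Beltraminelli–Merlini 2012, eq. (8) p. 257 with Remark 2): no definition, no new fact.

## The road (the printed one: "Volchkov published it after one integration by parts")

Write `w(t) = (1−12t²)/(1+4t²)³ = W'(t)` with `W(t) = t/(1+4t²)²`, `W(0) = W(∞) = 0`, and
`I(t) = ∫_{1/2}^∞ log|ζ(σ+it)| dσ`. Turing's lemma (`pi_mul_integral_zetaArgS_eq`, Lehman 1970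
Lemma 1, in the tree) gives `I(t) = I(1) + π ∫_1^t S(u) du` for every `t > 0` that is not the
ordinate of a zero (a.e. `t`; `t = 1` is not an ordinate since the first zero has ordinate `> 14`).
Hence, by Fubini over the two triangles `{1 < u ≤ t}` and `{t < u ≤ 1}` (joint integrability from
`S(u) = O(log u)`, `isBigO_zetaArgS_log_holds`, and `|w(t)| ≤ 3/(16t⁴)`),

  `V := ∫₀^∞ w(t) I(t) dt = I(1)·∫₀^∞ w + π ∫₀^∞ w(t) ∫_1^t S = 0 − π ∫₀^∞ W(u) S(u) du`,

i.e. UNCONDITIONALLY `∫₀^∞ 2uS(u)/(1/4+u²)² du = 32 ∫₀^∞ W S = −(32/π)·V`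
(`volchkovArg_integral_eq`), which with `volchkov_integral_eq` is
`γ − 3 − Σ_ρ m(ρ)·[Re ρ > 1/2]·Z(ρ)` (`volchkovArg_integral_eq_zeroSum`). The criterion
(`Volchkov1995_criterion_argForm_holds`) is then `Volchkov1995_criterion_holds` transported along
`V ↦ −(32/π)V`: `V = π(3−γ)/32 ⟺ −(32/π)V = γ − 3`.

RH-EQUIVALENT bookkeeping: a kernel equivalence "integral = value ⟺ RH"; neither side is asserted
and nothing here bears on the truth of RH.

## References

* [Volchkov1995] V. V. Volchkov, *On an equality equivalent to the Riemann hypothesis*, Ukr. Mat.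
  Zh. 47 (1995) 422–423 (Ukr. Math. J. 47, 491–493) — not held; statement as printed in
  SekatskiiBeltraminelliMerlini2012 eq. (8), Remark 2.
* [SekatskiiBeltraminelliMerlini2012] S. K. Sekatskii, S. Beltraminelli, D. Merlini, Ukr. Math.
  J. 64 (2012), §3.1, Thm. 5a, eq. (8) p. 257 and Remark 2 [corpus: paper:doi-10-1007-s11253-012-0642-0].
* [Lehman1970] R. S. Lehman, *On the distribution of zeros of the Riemann zeta-function*, Proc.
  LMS (3) 20 (1970), Lemma 1 (Turing's lemma; `ZetaArgVariation.lean`).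
* [Broughan2017] Vol. 2, Ch. 8 (not held).
-/

noncomputable section

open Complex Set Filter Topology MeasureTheory Real

namespace Literature.NumberTheory.LFunctions

namespace VolchkovArg

/-! ### §1 The weight `w(t) = (1−12t²)/(1+4t²)³` and its primitive `W(t) = t/(1+4t²)²` -/

/-- `W' = w`: `d/dt [t/(1+4t²)²] = (1−12t²)/(1+4t²)³`. [folklore] -/
private theorem hasDerivAt_W (t : ℝ) :
    HasDerivAt (fun t : ℝ ↦ t / (1 + 4 * t ^ 2) ^ 2) ((1 - 12 * t ^ 2) / (1 + 4 * t ^ 2) ^ 3) t := by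
  have hq : (0 : ℝ) < 1 + 4 * t ^ 2 := by positivity
  have h1 : HasDerivAt (fun t : ℝ ↦ 1 + 4 * t ^ 2) (4 * (2 * t)) t := by
    simpa using ((hasDerivAt_pow 2 t).const_mul 4).const_add 1
  have h2 : HasDerivAt (fun t : ℝ ↦ (1 + 4 * t ^ 2) ^ 2) (2 * (1 + 4 * t ^ 2) * (4 * (2 * t))) t := by
    simpa [Pi.pow_def] using h1.pow 2
  refine ((hasDerivAt_id t).fun_div h2 (by positivity)).congr_deriv ?_
  simp only [id]
  field_simp
  ring

/-- `|w(t)| ≤ 3/(1+4t²)²`. [folklore] -/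
private theorem abs_w_le (t : ℝ) :
    |(1 - 12 * t ^ 2) / (1 + 4 * t ^ 2) ^ 3| ≤ 3 / (1 + 4 * t ^ 2) ^ 2 := by
  have hq : (0 : ℝ) < 1 + 4 * t ^ 2 := by positivity
  rw [abs_div, abs_of_pos (by positivity : (0 : ℝ) < (1 + 4 * t ^ 2) ^ 3),
    div_le_div_iff₀ (by positivity) (by positivity)]
  have h : |1 - 12 * t ^ 2| ≤ 3 * (1 + 4 * t ^ 2) := by
    rw [abs_le]; constructor <;> nlinarith [sq_nonneg t]
  calc |1 - 12 * t ^ 2| * (1 + 4 * t ^ 2) ^ 2 ≤ 3 * (1 + 4 * t ^ 2) * (1 + 4 * t ^ 2) ^ 2 := by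
        gcongr
    _ = 3 * (1 + 4 * t ^ 2) ^ 3 := by ring

/-- `|w(t)| ≤ 3`. [folklore] -/
private theorem abs_w_le_three (t : ℝ) : |(1 - 12 * t ^ 2) / (1 + 4 * t ^ 2) ^ 3| ≤ 3 := by
  refine (abs_w_le t).trans ?_
  rw [div_le_iff₀ (by positivity)]
  nlinarith [sq_nonneg t, sq_nonneg (t ^ 2)]

/-- `|w(t)| ≤ 3/(16t⁴)` for `t ≥ 1`. [folklore] -/
private theorem abs_w_le_inv {t : ℝ} (ht : 1 ≤ t) :
    |(1 - 12 * t ^ 2) / (1 + 4 * t ^ 2) ^ 3| ≤ 3 / (16 * t ^ 4) := by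
  refine (abs_w_le t).trans ?_
  have h0 : (0 : ℝ) < t := by linarith
  exact div_le_div_of_nonneg_left (by norm_num) (by positivity) (by nlinarith [sq_nonneg t])

/-- `w` is continuous. [folklore] -/
private theorem continuous_w : Continuous fun t : ℝ ↦ (1 - 12 * t ^ 2) / (1 + 4 * t ^ 2) ^ 3 :=
  Continuous.div (by fun_prop) (by fun_prop) fun t ↦ by positivity

/-- `w` is integrable on `ℝ`. [folklore] -/
private theorem integrable_w : Integrable fun t : ℝ ↦ (1 - 12 * t ^ 2) / (1 + 4 * t ^ 2) ^ 3 := by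
  have h := (integrable_inv_one_add_sq).const_mul 3
  refine h.mono' continuous_w.aestronglyMeasurable (ae_of_all _ fun t ↦ ?_)
  rw [Real.norm_eq_abs]
  refine (abs_w_le t).trans ?_
  have h1 : (0 : ℝ) < 1 + t ^ 2 := by positivity
  rw [div_le_iff₀ (by positivity)]
  calc (3 : ℝ) = 3 * (1 + t ^ 2)⁻¹ * (1 + t ^ 2) := by field_simp
    _ ≤ 3 * (1 + t ^ 2)⁻¹ * (1 + 4 * t ^ 2) ^ 2 := by
        gcongr
        nlinarith [sq_nonneg t, sq_nonneg (t ^ 2)]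

/-- `W(t) → 0` as `t → ∞`. [folklore] -/
private theorem tendsto_W : Tendsto (fun t : ℝ ↦ t / (1 + 4 * t ^ 2) ^ 2) atTop (𝓝 0) := by
  refine tendsto_of_tendsto_of_tendsto_of_le_of_le' tendsto_const_nhds tendsto_inv_atTop_zero ?_ ?_
  · filter_upwards [eventually_gt_atTop 0] with t ht
    positivity
  · filter_upwards [eventually_gt_atTop 0] with t ht
    have h1 : t ^ 2 ≤ (1 + 4 * t ^ 2) ^ 2 := by nlinarith [sq_nonneg t, sq_nonneg (t ^ 2)]
    calc t / (1 + 4 * t ^ 2) ^ 2 ≤ t / t ^ 2 := div_le_div_of_nonneg_left ht.le (by positivity) h1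
      _ = t⁻¹ := by rw [sq, div_mul_eq_div_div, div_self ht.ne', one_div]

/-- `∫_u^∞ w = −W(u)`. [folklore] -/
private theorem integral_w_Ioi (u : ℝ) :
    ∫ t in Ioi u, (1 - 12 * t ^ 2) / (1 + 4 * t ^ 2) ^ 3 = -(u / (1 + 4 * u ^ 2) ^ 2) := by
  have h := integral_Ioi_of_hasDerivAt_of_tendsto (f := fun t : ℝ ↦ t / (1 + 4 * t ^ 2) ^ 2)
    (f' := fun t ↦ (1 - 12 * t ^ 2) / (1 + 4 * t ^ 2) ^ 3) (a := u) (m := 0)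
    (hasDerivAt_W u).continuousAt.continuousWithinAt (fun x _ ↦ hasDerivAt_W x)
    integrable_w.integrableOn tendsto_W
  rw [h, zero_sub]

/-- `∫_0^u w = W(u)` (`u ≥ 0`). [folklore] -/
private theorem integral_w_Ioo {u : ℝ} (hu : 0 ≤ u) :
    ∫ t in Ioo 0 u, (1 - 12 * t ^ 2) / (1 + 4 * t ^ 2) ^ 3 = u / (1 + 4 * u ^ 2) ^ 2 := by
  rw [setIntegral_congr_set Ioo_ae_eq_Ioc, ← intervalIntegral.integral_of_le hu,
    intervalIntegral.integral_eq_sub_of_hasDerivAt (fun x _ ↦ hasDerivAt_W x)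
      (continuous_w.intervalIntegrable 0 u)]
  simp

/-! ### §2 The Backlund function `S`: measurability and an affine bound -/

/-- `S = N − θ/π − 1` is measurable (`N` monotone, `θ` continuous). [folklore] -/
private theorem measurable_S : Measurable zetaArgS := by
  have hθc : Continuous riemannSiegelTheta :=
    continuous_iff_continuousAt.2 fun t ↦ (hasDerivAt_riemannSiegelTheta_holds t).continuousAt
  have hN : Monotone fun T : ℝ ↦ (zetaZeroCount T : ℝ) :=
    fun x y hxy ↦ Nat.cast_le.2 (zetaZeroCount_mono hxy)
  have e : zetaArgS = fun T ↦ (zetaZeroCount T : ℝ) - riemannSiegelTheta T / π - 1 := rfl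
  rw [e]
  exact (hN.measurable.sub (hθc.measurable.div_const π)).sub measurable_const

/-- An affine bound `|S(u)| ≤ K + c·u` on `u ≥ 0` (`S` is bounded on compacts — `N` monotone, `θ`
continuous — and `S(u) = O(log u)`, `isBigO_zetaArgS_log_holds`). [folklore] -/
private theorem exists_affine_bound_S :
    ∃ K c : ℝ, 0 ≤ K ∧ 0 ≤ c ∧ ∀ u : ℝ, 0 ≤ u → |zetaArgS u| ≤ K + c * u := by
  have hbig := isBigO_zetaArgS_log_holds
  rw [isBigO_zetaArgS_log, Asymptotics.isBigO_iff] at hbig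
  obtain ⟨c, hc⟩ := hbig
  obtain ⟨T, hT⟩ := eventually_atTop.1 hc
  set T₀ : ℝ := max T 1 with hT₀
  have hθc : Continuous riemannSiegelTheta :=
    continuous_iff_continuousAt.2 fun t ↦ (hasDerivAt_riemannSiegelTheta_holds t).continuousAt
  obtain ⟨M, hM⟩ := (isCompact_Icc (a := (0 : ℝ)) (b := T₀)).exists_bound_of_continuousOn
    hθc.continuousOn
  refine ⟨(zetaZeroCount T₀ : ℝ) + |M| / π + 1, max c 0, by positivity, le_max_right _ _,
    fun u hu ↦ ?_⟩
  rcases le_or_gt u T₀ with h | h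
  · -- the compact range
    have hN0 : (0 : ℝ) ≤ zetaZeroCount u := Nat.cast_nonneg _
    have hN1 : (zetaZeroCount u : ℝ) ≤ zetaZeroCount T₀ := Nat.cast_le.2 (zetaZeroCount_mono h)
    have hθ : |riemannSiegelTheta u| ≤ |M| := by
      have := hM u ⟨hu, h⟩
      rw [Real.norm_eq_abs] at this
      exact this.trans (le_abs_self M)
    have hθ' : |riemannSiegelTheta u / π| ≤ |M| / π := by
      rw [abs_div, abs_of_pos Real.pi_pos]
      exact div_le_div_of_nonneg_right hθ Real.pi_pos.le
    have hcu : 0 ≤ max c 0 * u := mul_nonneg (le_max_right _ _) hu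
    have e : zetaArgS u = (zetaZeroCount u : ℝ) - riemannSiegelTheta u / π - 1 := rfl
    rw [e, abs_le]
    obtain ⟨h1, h2⟩ := abs_le.1 hθ'
    constructor <;> linarith [div_nonneg (abs_nonneg M) Real.pi_pos.le]
  · -- the range `u > T₀ ≥ T`, where `|S u| ≤ c log u ≤ c u`
    have huT : T ≤ u := (le_max_left _ _).trans h.le
    have hu1 : 1 ≤ u := (le_max_right _ _).trans h.le
    have h1 := hT u huT
    rw [Real.norm_eq_abs, Real.norm_eq_abs, abs_of_nonneg (Real.log_nonneg hu1)] at h1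
    have h2 : c * Real.log u ≤ max c 0 * u :=
      (mul_le_mul_of_nonneg_right (le_max_left _ _) (Real.log_nonneg hu1)).trans
        (mul_le_mul_of_nonneg_left (Real.log_le_self hu) (le_max_right _ _))
    have h3 : (0 : ℝ) ≤ (zetaZeroCount T₀ : ℝ) + |M| / π + 1 := by positivity
    linarith

/-! ### §3 Turing's lemma from height `1`, almost everywhere -/

/-- `t = 1` is not the ordinate of a zero of `ζ` (no zero has `0 < Im ρ ≤ 14`). [folklore] -/
private theorem one_not_ordinate : ∀ ρ : ℂ, riemannZeta ρ = 0 → ρ.im ≠ 1 := by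
  intro ρ hρ h1
  exact riemannZeta_ne_zero_of_im_pos_of_im_le_fourteen (by rw [h1]; exact one_pos)
    (by rw [h1]; norm_num) hρ

/-- Turing's lemma from height `1`: for a.e. `t > 0`,
`∫_{1/2}^∞ log|ζ(σ+it)| dσ = ∫_{1/2}^∞ log|ζ(σ+i)| dσ + π ∫_1^t S(u) du`. [folklore] -/
private theorem ae_logIntegral_eq :
    ∀ᵐ t : ℝ ∂(volume.restrict (Ioi (0 : ℝ))),
      (∫ x in Ioi (1 / 2 : ℝ), Real.log ‖riemannZeta (x + t * I)‖) =
        (∫ x in Ioi (1 / 2 : ℝ), Real.log ‖riemannZeta (x + (1 : ℝ) * I)‖) +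
          π * ∫ u in (1 : ℝ)..t, zetaArgS u := by
  have h1 : ∀ᵐ t : ℝ ∂volume, ∀ n : ℕ, 0 < t → t ≤ (n : ℝ) →
      ∀ ρ : ℂ, riemannZeta ρ = 0 → ρ.im ≠ t :=
    ae_all_iff.2 fun n ↦ ae_not_ordinate (n : ℝ)
  filter_upwards [ae_restrict_of_ae (s := Ioi (0 : ℝ)) h1, ae_restrict_mem measurableSet_Ioi]
    with t ht h0
  have h0' : (0 : ℝ) < t := h0
  obtain ⟨n, hn⟩ := exists_nat_ge t
  have hnt := ht n h0' hn
  rcases le_total 1 t with h1t | ht1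
  · have := pi_mul_integral_zetaArgS_eq one_pos h1t one_not_ordinate hnt
    linarith
  · have := pi_mul_integral_zetaArgS_eq h0' ht1 hnt one_not_ordinate
    rw [intervalIntegral.integral_symm, mul_neg]
    linarith

/-! ### §4 The two triangles: joint integrability and the inner integrals -/

/-- Joint integrability on the upper triangle `{1 < u ≤ t}` of `w(t)S(u)` over
`(0,∞) × (0,∞)`, for any measurable `w, S` with `|w(t)| ≤ 3/(16t⁴)` (`t ≥ 1`) and
`|S(u)| ≤ K + cu` (`u ≥ 0`). [folklore] -/
private theorem integrable_upper {w S : ℝ → ℝ} (hwm : Measurable w) (hSm : Measurable S)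
    (hw4 : ∀ t : ℝ, 1 ≤ t → |w t| ≤ 3 / (16 * t ^ 4)) {K c : ℝ} (hK : 0 ≤ K) (hc : 0 ≤ c)
    (hSb : ∀ u : ℝ, 0 ≤ u → |S u| ≤ K + c * u) :
    Integrable (Function.uncurry fun t u : ℝ ↦ if 1 < u ∧ u ≤ t then w t * S u else 0)
      ((volume.restrict (Ioi (0 : ℝ))).prod (volume.restrict (Ioi (0 : ℝ)))) := by
  set μ : Measure ℝ := volume.restrict (Ioi (0 : ℝ)) with hμ
  have hmeas : Measurable (Function.uncurry fun t u : ℝ ↦ if 1 < u ∧ u ≤ t then w t * S u else 0) := by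
    show Measurable fun p : ℝ × ℝ ↦ if 1 < p.2 ∧ p.2 ≤ p.1 then w p.1 * S p.2 else 0
    refine Measurable.ite ?_ ((hwm.comp measurable_fst).mul (hSm.comp measurable_snd))
      measurable_const
    exact (measurableSet_lt measurable_const measurable_snd).inter
      (measurableSet_le measurable_snd measurable_fst)
  have h1f := hmeas.aestronglyMeasurable (μ := μ.prod μ)
  rw [integrable_prod_iff h1f]
  -- the sections `u ↦ F(t,u)` are indicators of `Ioc 1 t`
  have hsec : ∀ t : ℝ, (fun u : ℝ ↦ if 1 < u ∧ u ≤ t then w t * S u else 0) =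
      (Ioc 1 t).indicator fun u ↦ w t * S u := by
    intro t; funext u
    by_cases h : 1 < u ∧ u ≤ t
    · rw [if_pos h, Set.indicator_of_mem (show u ∈ Ioc 1 t from h)]
    · rw [if_neg h, Set.indicator_of_notMem (show u ∉ Ioc 1 t from h)]
  have hSB : ∀ t u : ℝ, u ∈ Ioc 1 t → |w t * S u| ≤ |w t| * (K + c * t) := by
    intro t u hu
    rw [abs_mul]
    refine mul_le_mul_of_nonneg_left ?_ (abs_nonneg _)
    have := hSb u (by linarith [hu.1])
    nlinarith [hu.2]
  have hIoc : ∀ t : ℝ, IntegrableOn (fun u ↦ w t * S u) (Ioc 1 t) volume := by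
    intro t
    refine Measure.integrableOn_of_bounded (M := |w t| * (K + c * t)) measure_Ioc_lt_top.ne
      ((measurable_const.mul hSm).aestronglyMeasurable) ?_
    exact (ae_restrict_iff' measurableSet_Ioc).2 (Eventually.of_forall fun u hu ↦ by
      rw [Real.norm_eq_abs]; exact hSB t u hu)
  constructor
  · refine Eventually.of_forall fun t ↦ ?_
    simp only [Function.uncurry_apply_pair]
    rw [hsec t]
    exact ((integrable_indicator_iff measurableSet_Ioc).2 (hIoc t)).mono_measure
      Measure.restrict_le_self
  -- the `t`-integrability of `∫_u |F(t,u)|`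
  have hnorm : ∀ t : ℝ, 0 < t → ∫ u, ‖Function.uncurry (fun t u : ℝ ↦
      if 1 < u ∧ u ≤ t then w t * S u else 0) (t, u)‖ ∂μ =
        ∫ u in Ioc 1 t, |w t * S u| := by
    intro t ht
    have e : ∫ u, ‖Function.uncurry (fun t u : ℝ ↦ if 1 < u ∧ u ≤ t then w t * S u else 0) (t, u)‖ ∂μ
        = ∫ u in Ioi (0 : ℝ), (Ioc 1 t).indicator (fun u ↦ |w t * S u|) u := by
      refine integral_congr_ae (ae_of_all _ fun u ↦ ?_)
      simp only [Function.uncurry_apply_pair]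
      by_cases h : 1 < u ∧ u ≤ t
      · rw [if_pos h, Set.indicator_of_mem (show u ∈ Ioc 1 t from h), Real.norm_eq_abs]
      · rw [if_neg h, Set.indicator_of_notMem (show u ∉ Ioc 1 t from h), norm_zero]
    rw [e, setIntegral_indicator measurableSet_Ioc,
      show Ioi (0 : ℝ) ∩ Ioc 1 t = Ioc 1 t from
        inter_eq_right.2 fun u hu ↦ lt_trans zero_lt_one hu.1]
  -- dominating function `(3(K+c)/16)/t²` on `t > 1`, `0` on `t ≤ 1`
  set g : ℝ → ℝ := (Ioi (1 : ℝ)).indicator fun t ↦ 3 * (K + c) / 16 * (t ^ 2)⁻¹ with hg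
  have hgint : Integrable g μ := by
    refine Integrable.mono_measure ?_ Measure.restrict_le_self
    rw [hg, integrable_indicator_iff measurableSet_Ioi]
    have h : IntegrableOn (fun t : ℝ ↦ 3 * (K + c) / 16 * t ^ (-2 : ℝ)) (Ioi 1) :=
      (integrableOn_Ioi_rpow_of_lt (show (-2 : ℝ) < -1 by norm_num) zero_lt_one).const_mul _
    refine h.congr_fun (fun t ht ↦ ?_) measurableSet_Ioi
    have ht0 : (0 : ℝ) < t := lt_trans zero_lt_one ht
    simp only
    rw [Real.rpow_neg ht0.le, Real.rpow_two]
  refine hgint.mono' h1f.norm.integral_prod_right' ?_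
  filter_upwards [ae_restrict_mem measurableSet_Ioi] with t ht
  have ht0 : (0 : ℝ) < t := ht
  rw [Real.norm_eq_abs, abs_of_nonneg (integral_nonneg fun u ↦ norm_nonneg _), hnorm t ht0]
  rcases le_or_gt t 1 with h1 | h1
  · rw [Ioc_eq_empty (fun h ↦ by linarith), Measure.restrict_empty, integral_zero_measure, hg,
      Set.indicator_of_notMem (show t ∉ Ioi (1 : ℝ) from fun h ↦ by
        simp only [mem_Ioi] at h; linarith)]
  · rw [hg, Set.indicator_of_mem (show t ∈ Ioi (1 : ℝ) from h1)]
    have hb := norm_setIntegral_le_of_norm_le_const (μ := volume) (s := Ioc 1 t)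
      (f := fun u ↦ |w t * S u|) (C := |w t| * (K + c * t)) measure_Ioc_lt_top
      (fun u hu ↦ by rw [Real.norm_eq_abs, abs_abs]; exact hSB t u hu)
    rw [Real.norm_eq_abs, abs_of_nonneg (integral_nonneg fun u ↦ abs_nonneg _),
      Real.volume_real_Ioc_of_le h1.le] at hb
    refine hb.trans ?_
    have hw := hw4 t h1.le
    have hKc : K + c * t ≤ (K + c) * t := by nlinarith
    have ht0' : (0 : ℝ) < t := lt_trans zero_lt_one h1
    calc |w t| * (K + c * t) * (t - 1) ≤ 3 / (16 * t ^ 4) * ((K + c) * t) * t :=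
          mul_le_mul (mul_le_mul hw hKc (by positivity) (by positivity)) (by linarith)
            (by linarith) (by positivity)
      _ = 3 * (K + c) / 16 * (t ^ 2)⁻¹ := by field_simp

/-- Joint integrability on the lower triangle `{t < u ≤ 1}` of `w(t)S(u)` over `(0,∞) × (0,∞)`,
for any measurable `w, S` with `|w| ≤ 3` and `|S(u)| ≤ K + cu` (`u ≥ 0`). [folklore] -/
private theorem integrable_lower {w S : ℝ → ℝ} (hwm : Measurable w) (hSm : Measurable S)
    (hw3 : ∀ t : ℝ, |w t| ≤ 3) {K c : ℝ} (hK : 0 ≤ K) (hc : 0 ≤ c)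
    (hSb : ∀ u : ℝ, 0 ≤ u → |S u| ≤ K + c * u) :
    Integrable (Function.uncurry fun t u : ℝ ↦ if t < u ∧ u ≤ 1 then w t * S u else 0)
      ((volume.restrict (Ioi (0 : ℝ))).prod (volume.restrict (Ioi (0 : ℝ)))) := by
  set μ : Measure ℝ := volume.restrict (Ioi (0 : ℝ)) with hμ
  have hmeas : Measurable (Function.uncurry fun t u : ℝ ↦ if t < u ∧ u ≤ 1 then w t * S u else 0) := by
    show Measurable fun p : ℝ × ℝ ↦ if p.1 < p.2 ∧ p.2 ≤ 1 then w p.1 * S p.2 else 0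
    refine Measurable.ite ?_ ((hwm.comp measurable_fst).mul (hSm.comp measurable_snd))
      measurable_const
    exact (measurableSet_lt measurable_fst measurable_snd).inter
      (measurableSet_le measurable_snd measurable_const)
  have h1f := hmeas.aestronglyMeasurable (μ := μ.prod μ)
  rw [integrable_prod_iff h1f]
  have hsec : ∀ t : ℝ, (fun u : ℝ ↦ if t < u ∧ u ≤ 1 then w t * S u else 0) =
      (Ioc t 1).indicator fun u ↦ w t * S u := by
    intro t; funext u
    by_cases h : t < u ∧ u ≤ 1
    · rw [if_pos h, Set.indicator_of_mem (show u ∈ Ioc t 1 from h)]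
    · rw [if_neg h, Set.indicator_of_notMem (show u ∉ Ioc t 1 from h)]
  have hSB : ∀ t u : ℝ, 0 < t → u ∈ Ioc t 1 → |w t * S u| ≤ 3 * (K + c) := by
    intro t u ht hu
    rw [abs_mul]
    have h1 := hSb u (by linarith [hu.1])
    have h2 : |S u| ≤ K + c := by nlinarith [hu.2]
    exact mul_le_mul (hw3 t) h2 (abs_nonneg _) (by norm_num)
  have hIoc : ∀ t : ℝ, 0 < t → IntegrableOn (fun u ↦ w t * S u) (Ioc t 1) volume := by
    intro t ht
    refine Measure.integrableOn_of_bounded (M := 3 * (K + c)) measure_Ioc_lt_top.ne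
      ((measurable_const.mul hSm).aestronglyMeasurable) ?_
    exact (ae_restrict_iff' measurableSet_Ioc).2 (Eventually.of_forall fun u hu ↦ by
      rw [Real.norm_eq_abs]; exact hSB t u ht hu)
  constructor
  · filter_upwards [ae_restrict_mem measurableSet_Ioi] with t ht
    have ht0 : (0 : ℝ) < t := ht
    simp only [Function.uncurry_apply_pair]
    rw [hsec t]
    exact ((integrable_indicator_iff measurableSet_Ioc).2 (hIoc t ht0)).mono_measure
      Measure.restrict_le_self
  have hnorm : ∀ t : ℝ, 0 < t → ∫ u, ‖Function.uncurry (fun t u : ℝ ↦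
      if t < u ∧ u ≤ 1 then w t * S u else 0) (t, u)‖ ∂μ =
        ∫ u in Ioc t 1, |w t * S u| := by
    intro t ht
    have e : ∫ u, ‖Function.uncurry (fun t u : ℝ ↦ if t < u ∧ u ≤ 1 then w t * S u else 0) (t, u)‖ ∂μ
        = ∫ u in Ioi (0 : ℝ), (Ioc t 1).indicator (fun u ↦ |w t * S u|) u := by
      refine integral_congr_ae (ae_of_all _ fun u ↦ ?_)
      simp only [Function.uncurry_apply_pair]
      by_cases h : t < u ∧ u ≤ 1
      · rw [if_pos h, Set.indicator_of_mem (show u ∈ Ioc t 1 from h), Real.norm_eq_abs]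
      · rw [if_neg h, Set.indicator_of_notMem (show u ∉ Ioc t 1 from h), norm_zero]
    rw [e, setIntegral_indicator measurableSet_Ioc,
      show Ioi (0 : ℝ) ∩ Ioc t 1 = Ioc t 1 from
        inter_eq_right.2 fun u hu ↦ lt_trans ht hu.1]
  -- dominating function: the constant `3(K+c)` on `(0,1]`, `0` beyond
  set g : ℝ → ℝ := (Iic (1 : ℝ)).indicator fun _ ↦ 3 * (K + c) with hg
  have hgint : Integrable g μ := by
    rw [hg, integrable_indicator_iff measurableSet_Iic, IntegrableOn, hμ,
      Measure.restrict_restrict measurableSet_Iic]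
    refine integrableOn_const ?_
    rw [show Iic (1 : ℝ) ∩ Ioi 0 = Ioc 0 1 by ext x; simp [and_comm], Real.volume_Ioc]
    exact ENNReal.ofReal_ne_top
  refine hgint.mono' h1f.norm.integral_prod_right' ?_
  filter_upwards [ae_restrict_mem measurableSet_Ioi] with t ht
  have ht0 : (0 : ℝ) < t := ht
  rw [Real.norm_eq_abs, abs_of_nonneg (integral_nonneg fun u ↦ norm_nonneg _), hnorm t ht0]
  rcases lt_or_ge 1 t with h1 | h1
  · rw [Ioc_eq_empty (fun h ↦ by linarith), Measure.restrict_empty, integral_zero_measure, hg,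
      Set.indicator_of_notMem (show t ∉ Iic (1 : ℝ) from fun h ↦ by
        simp only [mem_Iic] at h; linarith)]
  · rw [hg, Set.indicator_of_mem (show t ∈ Iic (1 : ℝ) from h1)]
    have hb := norm_setIntegral_le_of_norm_le_const (μ := volume) (s := Ioc t 1)
      (f := fun u ↦ |w t * S u|) (C := 3 * (K + c)) measure_Ioc_lt_top
      (fun u hu ↦ by rw [Real.norm_eq_abs, abs_abs]; exact hSB t u ht0 hu)
    rw [Real.norm_eq_abs, abs_of_nonneg (integral_nonneg fun u ↦ abs_nonneg _),
      Real.volume_real_Ioc_of_le h1] at hb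
    refine hb.trans ?_
    have : (0 : ℝ) ≤ 3 * (K + c) := by positivity
    nlinarith

end VolchkovArg

open VolchkovArg in
/-- **Volchkov's `arg` integral as an integration by parts of his double integral** (RH-FREE,
unconditional): with `S = zetaArgS`,

  `∫₀^∞ 2t·S(t)/(1/4+t²)² dt = −(32/π) · ∫₀^∞ (1−12t²)/(1+4t²)³ ∫_{1/2}^∞ log|ζ(σ+it)| dσ dt`.

Proof: Turing's lemma `∫_{1/2}^∞ log|ζ(σ+it)| dσ = const + π∫_1^t S` (a.e. `t`), `(1−12t²)/(1+4t²)³ =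
d/dt [t/(1+4t²)²]` with `∫₀^∞ (1−12t²)/(1+4t²)³ dt = 0`, and Fubini over the triangles
`{1 < u ≤ t}`, `{t < u ≤ 1}`; `2t/(1/4+t²)² = 32·t/(1+4t²)²`. This is the "one integration by
parts" of Sekatskii–Beltraminelli–Merlini's Remark 2.
[cite: SekatskiiBeltraminelliMerlini2012, §3.1 eq. (8) p. 257 and Remark 2] -/
theorem volchkovArg_integral_eq :
    ∫ t in Ioi (0 : ℝ), 2 * t * zetaArgS t / (1 / 4 + t ^ 2) ^ 2 =
      -(32 / π) * ∫ t in Ioi (0 : ℝ), (1 - 12 * t ^ 2) / (1 + 4 * t ^ 2) ^ 3 *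
        ∫ σ in Ioi (1 / 2 : ℝ), Real.log ‖riemannZeta (σ + t * I)‖ := by
  set μ : Measure ℝ := volume.restrict (Ioi (0 : ℝ)) with hμ
  set w : ℝ → ℝ := fun t ↦ (1 - 12 * t ^ 2) / (1 + 4 * t ^ 2) ^ 3 with hw
  set W : ℝ → ℝ := fun t ↦ t / (1 + 4 * t ^ 2) ^ 2 with hW
  set Λ : ℝ → ℝ := fun t ↦ ∫ x in Ioi (1 / 2 : ℝ), Real.log ‖riemannZeta (x + t * I)‖ with hΛ
  obtain ⟨K, c, hK, hc, hSb⟩ := exists_affine_bound_S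
  have hwm : Measurable w := continuous_w.measurable
  -- the two triangle integrands
  set F₁ : ℝ → ℝ → ℝ := fun t u ↦ if 1 < u ∧ u ≤ t then w t * zetaArgS u else 0 with hF₁
  set F₂ : ℝ → ℝ → ℝ := fun t u ↦ if t < u ∧ u ≤ 1 then w t * zetaArgS u else 0 with hF₂
  have hF₁i : Integrable (Function.uncurry F₁) (μ.prod μ) :=
    integrable_upper hwm measurable_S (fun t ht ↦ abs_w_le_inv ht) hK hc hSb
  have hF₂i : Integrable (Function.uncurry F₂) (μ.prod μ) :=
    integrable_lower hwm measurable_S abs_w_le_three hK hc hSb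
  -- (a) the `u`-integrals of the triangle integrands recover `w(t) ∫_1^t S`
  have hinner : ∀ t : ℝ, 0 < t →
      (∫ u, F₁ t u ∂μ) - ∫ u, F₂ t u ∂μ = w t * ∫ u in (1 : ℝ)..t, zetaArgS u := by
    intro t ht
    have i1 : ∫ u, F₁ t u ∂μ = w t * ∫ u in Ioc 1 t, zetaArgS u := by
      have e : ∫ u, F₁ t u ∂μ = ∫ u in Ioi (0 : ℝ), (Ioc 1 t).indicator (fun u ↦ w t * zetaArgS u) u := by
        refine integral_congr_ae (ae_of_all _ fun u ↦ ?_)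
        simp only [hF₁]
        by_cases h : 1 < u ∧ u ≤ t
        · rw [if_pos h, Set.indicator_of_mem (show u ∈ Ioc 1 t from h)]
        · rw [if_neg h, Set.indicator_of_notMem (show u ∉ Ioc 1 t from h)]
      rw [e, setIntegral_indicator measurableSet_Ioc,
        show Ioi (0 : ℝ) ∩ Ioc 1 t = Ioc 1 t from
          inter_eq_right.2 fun u hu ↦ lt_trans zero_lt_one hu.1, integral_const_mul]
    have i2 : ∫ u, F₂ t u ∂μ = w t * ∫ u in Ioc t 1, zetaArgS u := by
      have e : ∫ u, F₂ t u ∂μ = ∫ u in Ioi (0 : ℝ), (Ioc t 1).indicator (fun u ↦ w t * zetaArgS u) u := by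
        refine integral_congr_ae (ae_of_all _ fun u ↦ ?_)
        simp only [hF₂]
        by_cases h : t < u ∧ u ≤ 1
        · rw [if_pos h, Set.indicator_of_mem (show u ∈ Ioc t 1 from h)]
        · rw [if_neg h, Set.indicator_of_notMem (show u ∉ Ioc t 1 from h)]
      rw [e, setIntegral_indicator measurableSet_Ioc,
        show Ioi (0 : ℝ) ∩ Ioc t 1 = Ioc t 1 from
          inter_eq_right.2 fun u hu ↦ lt_trans ht hu.1, integral_const_mul]
    rw [i1, i2, ← mul_sub]
    rfl
  -- (b) the a.e. identity for the integrand of `V`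
  have hV_ae : ∀ᵐ t ∂μ, w t * Λ t = w t * Λ 1 + π * ((∫ u, F₁ t u ∂μ) - ∫ u, F₂ t u ∂μ) := by
    filter_upwards [ae_logIntegral_eq, ae_restrict_mem measurableSet_Ioi] with t ht h0
    have h0' : (0 : ℝ) < t := h0
    rw [hinner t h0']
    simp only [hΛ]
    rw [ht]
    push_cast
    ring
  -- (c) integrate over `t`
  have hwint : Integrable w μ := integrable_w.mono_measure Measure.restrict_le_self
  have hG₁ : Integrable (fun t ↦ ∫ u, F₁ t u ∂μ) μ := hF₁i.integral_prod_left
  have hG₂ : Integrable (fun t ↦ ∫ u, F₂ t u ∂μ) μ := hF₂i.integral_prod_left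
  have hG : Integrable (fun t ↦ π * ((∫ u, F₁ t u ∂μ) - ∫ u, F₂ t u ∂μ)) μ :=
    (hG₁.sub hG₂).const_mul π
  have hV : ∫ t, w t * Λ t ∂μ =
      (∫ t, w t ∂μ) * Λ 1 + π * ((∫ t, ∫ u, F₁ t u ∂μ ∂μ) - ∫ t, ∫ u, F₂ t u ∂μ ∂μ) := by
    rw [integral_congr_ae hV_ae, integral_add (hwint.mul_const _) hG, integral_mul_const,
      integral_const_mul, integral_sub hG₁ hG₂]
  -- (d) `∫₀^∞ w = 0`
  have hw0 : ∫ t, w t ∂μ = 0 := by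
    simp only [hμ, hw]
    rw [integral_w_Ioi 0]
    simp
  -- (e) Fubini and the inner `t`-integrals
  have hsw₁ : ∫ t, ∫ u, F₁ t u ∂μ ∂μ = ∫ u, ∫ t, F₁ t u ∂μ ∂μ := integral_integral_swap hF₁i
  have hsw₂ : ∫ t, ∫ u, F₂ t u ∂μ ∂μ = ∫ u, ∫ t, F₂ t u ∂μ ∂μ := integral_integral_swap hF₂i
  have hin₁ : ∀ u : ℝ, 0 < u → ∫ t, F₁ t u ∂μ = if 1 < u then -(W u * zetaArgS u) else 0 := by
    intro u hu
    by_cases h1 : 1 < u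
    · rw [if_pos h1]
      have e : ∫ t, F₁ t u ∂μ = ∫ t in Ioi (0 : ℝ), (Ici u).indicator (fun t ↦ w t * zetaArgS u) t := by
        refine integral_congr_ae (ae_of_all _ fun t ↦ ?_)
        simp only [hF₁]
        by_cases h : u ≤ t
        · rw [if_pos ⟨h1, h⟩, Set.indicator_of_mem (show t ∈ Ici u from h)]
        · rw [if_neg (fun h' ↦ h h'.2), Set.indicator_of_notMem (show t ∉ Ici u from h)]
      rw [e, setIntegral_indicator measurableSet_Ici,
        show Ioi (0 : ℝ) ∩ Ici u = Ici u from inter_eq_right.2 fun t ht ↦ lt_of_lt_of_le hu ht,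
        integral_mul_const, integral_Ici_eq_integral_Ioi]
      simp only [hw, hW]
      rw [integral_w_Ioi u]
      ring
    · rw [if_neg h1]
      have e : ∫ t, F₁ t u ∂μ = ∫ t, (0 : ℝ) ∂μ := by
        refine integral_congr_ae (ae_of_all _ fun t ↦ ?_)
        simp only [hF₁]
        rw [if_neg (fun h ↦ h1 h.1)]
      rw [e, integral_zero]
  have hin₂ : ∀ u : ℝ, 0 < u → ∫ t, F₂ t u ∂μ = if u ≤ 1 then W u * zetaArgS u else 0 := by
    intro u hu
    by_cases h1 : u ≤ 1
    · rw [if_pos h1]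
      have e : ∫ t, F₂ t u ∂μ = ∫ t in Ioi (0 : ℝ), (Iio u).indicator (fun t ↦ w t * zetaArgS u) t := by
        refine integral_congr_ae (ae_of_all _ fun t ↦ ?_)
        simp only [hF₂]
        by_cases h : t < u
        · rw [if_pos ⟨h, h1⟩, Set.indicator_of_mem (show t ∈ Iio u from h)]
        · rw [if_neg (fun h' ↦ h h'.1), Set.indicator_of_notMem (show t ∉ Iio u from h)]
      rw [e, setIntegral_indicator measurableSet_Iio, Ioi_inter_Iio, integral_mul_const]
      simp only [hw, hW]
      rw [integral_w_Ioo hu.le]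
    · rw [if_neg h1]
      have e : ∫ t, F₂ t u ∂μ = ∫ t, (0 : ℝ) ∂μ := by
        refine integral_congr_ae (ae_of_all _ fun t ↦ ?_)
        simp only [hF₂]
        rw [if_neg (fun h ↦ h1 h.2)]
      rw [e, integral_zero]
  have hH₁ : Integrable (fun u ↦ ∫ t, F₁ t u ∂μ) μ := hF₁i.integral_prod_right
  have hH₂ : Integrable (fun u ↦ ∫ t, F₂ t u ∂μ) μ := hF₂i.integral_prod_right
  have hdiff : (∫ u, ∫ t, F₁ t u ∂μ ∂μ) - ∫ u, ∫ t, F₂ t u ∂μ ∂μ = -∫ u, W u * zetaArgS u ∂μ := by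
    rw [← integral_sub hH₁ hH₂, ← integral_neg]
    refine integral_congr_ae ?_
    filter_upwards [ae_restrict_mem measurableSet_Ioi] with u hu
    have hu0 : (0 : ℝ) < u := hu
    rw [hin₁ u hu0, hin₂ u hu0]
    by_cases h : 1 < u
    · rw [if_pos h, if_neg (not_le.2 h)]; ring
    · rw [if_neg h, if_pos (not_lt.1 h)]; ring
  -- (f) assemble: `V = −π ∫ W S` and `2t/(1/4+t²)² = 32 W(t)`
  have hVval : ∫ t, w t * Λ t ∂μ = -π * ∫ u, W u * zetaArgS u ∂μ := by
    rw [hV, hw0, hsw₁, hsw₂, hdiff]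
    ring
  have hlhs : ∫ t in Ioi (0 : ℝ), 2 * t * zetaArgS t / (1 / 4 + t ^ 2) ^ 2 =
      32 * ∫ u, W u * zetaArgS u ∂μ := by
    rw [← integral_const_mul]
    refine integral_congr_ae (ae_of_all _ fun t ↦ ?_)
    simp only [hW]
    have h1 : (1 / 4 + t ^ 2) ^ 2 ≠ 0 := by positivity
    have h2 : (1 + 4 * t ^ 2) ^ 2 ≠ 0 := by positivity
    field_simp
    ring
  have hπ : (π : ℝ) ≠ 0 := Real.pi_pos.ne'
  show (∫ t in Ioi (0 : ℝ), 2 * t * zetaArgS t / (1 / 4 + t ^ 2) ^ 2) = -(32 / π) * ∫ t, w t * Λ t ∂μ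
  rw [hlhs, hVval]
  field_simp

/-- **The value of Volchkov's `arg` integral** (RH-FREE, unconditional):

  `∫₀^∞ 2t·S(t)/(1/4+t²)² dt = γ − 3 − Σ_ρ m(ρ)·[Re ρ > 1/2]·Z(ρ)`,
  `Z(ρ) = β/|ρ|² + (1−β)/|1−ρ|² − 1/(1/4+γ²)` (`ρ = β+iγ`),

the sum over the distinct non-trivial zeros with multiplicity `m(ρ)` (`volchkov_integral_eq`
transported by `volchkovArg_integral_eq`).
[cite: SekatskiiBeltraminelliMerlini2012, §3.1 Thm. 5a, eq. (8) p. 257 and Remark 2] -/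
theorem volchkovArg_integral_eq_zeroSum :
    ∫ t in Ioi (0 : ℝ), 2 * t * zetaArgS t / (1 / 4 + t ^ 2) ^ 2 =
      Real.eulerMascheroniConstant - 3 -
        ∑' ρ : ZetaZeros.riemannZetaNontrivialZeros,
          (riemannZetaZeroOrder (ρ : ℂ) : ℝ) *
            (if 1 / 2 < (ρ : ℂ).re then
              (ρ : ℂ).re / ((ρ : ℂ).re ^ 2 + (ρ : ℂ).im ^ 2) +
                (1 - (ρ : ℂ).re) / ((1 - (ρ : ℂ).re) ^ 2 + (ρ : ℂ).im ^ 2) -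
                  1 / (1 / 4 + (ρ : ℂ).im ^ 2)
            else 0) := by
  rw [volchkovArg_integral_eq, volchkov_integral_eq]
  have hπ : (π : ℝ) ≠ 0 := Real.pi_pos.ne'
  field_simp
  ring

/-- **Volchkov's criterion, `arg ζ` form** — DISCHARGE of the named fact
`Volchkov1995_criterion_argForm`: `RH ⟺ ∫₀^∞ 2t·S(t)/(1/4+t²)² dt = γ − 3`
(`S = zetaArgS`, `γ = Real.eulerMascheroniConstant`). From `Volchkov1995_criterion_holds`
(`RH ⟺ V = π(3−γ)/32`) and `volchkovArg_integral_eq` (the `arg` integral is `−(32/π)V`).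
A kernel EQUIVALENCE; neither side is asserted; nothing here bears on the truth of RH.
[cite: Volchkov1995, Theorem (arg form; as printed in SekatskiiBeltraminelliMerlini2012 eq. (8), p. 257)] -/
theorem Volchkov1995_criterion_argForm_holds : Volchkov1995_criterion_argForm := by
  unfold Volchkov1995_criterion_argForm
  have hV := Volchkov1995_criterion_holds
  unfold Volchkov1995_criterion at hV
  rw [hV, volchkovArg_integral_eq]
  set V := ∫ t in Ioi (0 : ℝ), (1 - 12 * t ^ 2) / (1 + 4 * t ^ 2) ^ 3 *
    ∫ σ in Ioi (1 / 2 : ℝ), Real.log ‖riemannZeta (σ + t * I)‖ with hVdef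
  have hπ : (π : ℝ) ≠ 0 := Real.pi_pos.ne'
  constructor
  · intro h
    rw [h]
    field_simp
    ring
  · intro h
    have : V = -(32 / π) * V * (-(π / 32)) := by
      field_simp
    rw [this, h]
    ring

end Literature.NumberTheory.LFunctions
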